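import Mathlib

/-!
# Stub `stub_windowLimitOfPointwise` (A1) of line `drude-controls-conductance` (R2) — crux
`JunctionLocality.NonBallistic` (stmt-AtomisticToContinuum-9127)

Helper file (`--supports stmt-AtomisticToContinuum-9127`); nothing here closes the item.

Pure real analysis (Mathlib only): the dominated-convergence step for the window functional
`V_N(t) = 2 ∫₀ᵗ (t - s) f_N(s) ds` at FIXED `t > 0`. If the `f_N` are continuous, `|f_N(s)| ≤ B · N` on
`s ≥ 0`, and `f_N(s) / N → g(s)` for every `s ≥ 0` (with `g` measurable), then
`V_N(t) / N → v(t) := 2 ∫₀ᵗ (t - s) g(s) ds`.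

Proof: `(2 ∫₀ᵗ (t - s) f_N(s) ds) / N = 2 ∫₀ᵗ (t - s) (f_N(s) / N) ds` for every `N` (for `N = 0` both sides
are the junk value `0`); on `Ι 0 t = Ioc 0 t` the integrands `(t - s) (f_N(s) / N)` are continuous, converge
pointwise to `(t - s) g(s)`, and for `N ≥ 1` are dominated by the constant `t · max B 0`; conclude with
`intervalIntegral.tendsto_integral_filter_of_dominated_convergence` and `Tendsto.const_mul`.
-/

namespace Summit.AtomisticToContinuum.FouriersLaw.Theorems.NonBallistic

open MeasureTheory Filter Topology

/-- **Stub `stub_windowLimitOfPointwise`** (A1, registered stub 11 of line `drude-controls-conductance`, R2;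
pure real analysis): dominated convergence for the window functional — if the `f N` are continuous,
`|f N s| ≤ B · N` on `s ≥ 0`, and `f N s / N → g s` for every `s ≥ 0` with `g` measurable, then for every
`t > 0`, `(2 ∫₀ᵗ (t - s) f N s ds) / N → 2 ∫₀ᵗ (t - s) g s ds`. -/
theorem stub_windowLimitOfPointwise :
    ∀ (f : ℕ → ℝ → ℝ) (g : ℝ → ℝ) (B : ℝ), (∀ N : ℕ, Continuous (f N)) → Measurable g →
      (∀ N : ℕ, ∀ s : ℝ, 0 ≤ s → |f N s| ≤ B * (N : ℝ)) →
      (∀ s : ℝ, 0 ≤ s → Tendsto (fun N : ℕ => f N s / (N : ℝ)) atTop (𝓝 (g s))) →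
      ∀ t : ℝ, 0 < t →
        Tendsto (fun N : ℕ => (2 * ∫ s in (0 : ℝ)..t, (t - s) * f N s) / (N : ℝ)) atTop
          (𝓝 (2 * ∫ s in (0 : ℝ)..t, (t - s) * g s)) := by
  intro f g B hf _hg hB hlim t ht
  -- dominated convergence for the integrands `(t - s) * (f N s / N)` on `Ι 0 t = Ioc 0 t`
  have key : Tendsto (fun N : ℕ => ∫ s in (0 : ℝ)..t, (t - s) * (f N s / (N : ℝ))) atTop
      (𝓝 (∫ s in (0 : ℝ)..t, (t - s) * g s)) := by
    refine intervalIntegral.tendsto_integral_filter_of_dominated_convergence (fun _ => t * max B 0)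
      ?_ ?_ ?_ ?_
    · -- measurability, from continuity
      exact Eventually.of_forall fun N =>
        ((continuous_const.sub continuous_id).mul ((hf N).div_const _)).aestronglyMeasurable
    · -- domination by the constant `t * max B 0` for `N ≥ 1`
      filter_upwards [eventually_ge_atTop 1] with N hN
      refine Eventually.of_forall fun s hs => ?_
      rw [Set.uIoc_of_le ht.le] at hs
      have hNpos : (0 : ℝ) < (N : ℝ) := Nat.cast_pos.mpr hN
      have h1 : |t - s| ≤ t := by
        rw [abs_of_nonneg (sub_nonneg.mpr hs.2)]
        linarith [hs.1]
      have h2 : |f N s / (N : ℝ)| ≤ max B 0 := by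
        rw [abs_div, abs_of_pos hNpos, div_le_iff₀ hNpos]
        exact (hB N s hs.1.le).trans (mul_le_mul_of_nonneg_right (le_max_left B 0) hNpos.le)
      rw [Real.norm_eq_abs, abs_mul]
      exact mul_le_mul h1 h2 (abs_nonneg _) ht.le
    · exact intervalIntegrable_const
    · -- pointwise convergence on `Ioc 0 t ⊆ {s | 0 ≤ s}`
      refine Eventually.of_forall fun s hs => ?_
      rw [Set.uIoc_of_le ht.le] at hs
      exact (hlim s hs.1.le).const_mul (t - s)
  -- `(2 * ∫ (t - s) * f N s) / N = 2 * ∫ (t - s) * (f N s / N)` for every `N` (junk value `0` at `N = 0`)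
  have hrw : ∀ N : ℕ, (2 * ∫ s in (0 : ℝ)..t, (t - s) * f N s) / (N : ℝ) =
      2 * ∫ s in (0 : ℝ)..t, (t - s) * (f N s / (N : ℝ)) := by
    intro N
    rw [mul_div_assoc, ← intervalIntegral.integral_div]
    simp_rw [mul_div_assoc]
  simp_rw [hrw]
  exact key.const_mul 2

end Summit.AtomisticToContinuum.FouriersLaw.Theorems.NonBallistic
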